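import Mathlib

/-!
# The outside-elimination case split (blind cell PercRepro2, p4 g19; proofs/P4-G19-OUTSIDE.md §1; no definitions)

`E⁰ = Σ_{i ≤ j} x_i x_j C_ij` over the ten outside pairs present (x0 = a₂cu, x1 = a₂c|u, x2 = a₂u|c, x3 = a₂|cu,
x4 = a₂|c|u): with the outside atoms nonnegative, the one outside Harris fact `x1·x2 ≤ x0·(x3 + x4)`
(P(a₂ ~ c)·P(a₂ ~ u) ≤ P(a₂ ~ c ∧ a₂ ~ u)), nine pocket coefficients nonnegative and the two repaired sums
`C12 + C03 ≥ 0`, `C12 + C04 ≥ 0`, the sum is nonnegative: if `C12 ≥ 0` every term is, otherwise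
`x1 x2 C12 ≥ x0 (x3 + x4) C12` and the two repaired sums take over (`E0_nonneg_of_coeffs`).  The identification
of the `C_ij` with the pocket polynomials of the paper and of `E⁰` with the instance functional is the bridge
still to be typed (paper §7, §9).
-/

namespace Summit.Ventures.PercRepro2

namespace RootLeafU

namespace PocketCaseSplit

variable {R : Type*} [Field R] [LinearOrder R] [IsStrictOrderedRing R]

/-- **The case split of the outside elimination**: from the signs of the ten coefficients and the one Harris
fact of the outside, `Σ x_i x_j C_ij ≥ 0`. -/
theorem E0_nonneg_of_coeffs (x0 x1 x2 x3 x4 : R) (h0 : 0 ≤ x0) (h1 : 0 ≤ x1) (h2 : 0 ≤ x2) (h3 : 0 ≤ x3)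
    (h4 : 0 ≤ x4) (hH : x1 * x2 ≤ x0 * (x3 + x4))
    (C03 C04 C12 C13 C14 C23 C24 C33 C34 C44 : R)
    (c03 : 0 ≤ C03) (c04 : 0 ≤ C04) (c13 : 0 ≤ C13) (c14 : 0 ≤ C14) (c23 : 0 ≤ C23) (c24 : 0 ≤ C24)
    (c33 : 0 ≤ C33) (c34 : 0 ≤ C34) (c44 : 0 ≤ C44) (c1203 : 0 ≤ C12 + C03) (c1204 : 0 ≤ C12 + C04) :
    0 ≤ x0 * x3 * C03 + x0 * x4 * C04 + x1 * x2 * C12 + x1 * x3 * C13 + x1 * x4 * C14 + x2 * x3 * C23 +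
      x2 * x4 * C24 + x3 * x3 * C33 + x3 * x4 * C34 + x4 * x4 * C44 := by
  have t13 := mul_nonneg (mul_nonneg h1 h3) c13
  have t14 := mul_nonneg (mul_nonneg h1 h4) c14
  have t23 := mul_nonneg (mul_nonneg h2 h3) c23
  have t24 := mul_nonneg (mul_nonneg h2 h4) c24
  have t33 := mul_nonneg (mul_nonneg h3 h3) c33
  have t34 := mul_nonneg (mul_nonneg h3 h4) c34
  have t44 := mul_nonneg (mul_nonneg h4 h4) c44
  rcases le_or_gt 0 C12 with hc | hc
  · have t03 := mul_nonneg (mul_nonneg h0 h3) c03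
    have t04 := mul_nonneg (mul_nonneg h0 h4) c04
    have t12 := mul_nonneg (mul_nonneg h1 h2) hc
    linarith
  · -- `x1 x2 C12 ≥ x0 (x3 + x4) C12` since `C12 < 0` and `x1 x2 ≤ x0 (x3 + x4)`
    have key : x0 * (x3 + x4) * C12 ≤ x1 * x2 * C12 := by
      have := mul_le_mul_of_nonpos_right hH hc.le
      linarith
    have s03 := mul_nonneg (mul_nonneg h0 h3) c1203
    have s04 := mul_nonneg (mul_nonneg h0 h4) c1204
    nlinarith

end PocketCaseSplit

end RootLeafU

end Summit.Ventures.PercRepro2
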